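import Literature.NumberTheory.Automorphic.GL2CESHNonvanishing
import Literature.NumberTheory.Automorphic.HeckeLocalSumFixedRepresentative
import Literature.NumberTheory.Automorphic.AutomorphicRepsGLSatakeFlathProofs
import Literature.NumberTheory.Automorphic.AutomorphicCohomologyGLnCoeffHecke
import Literature.NumberTheory.Automorphic.BianchiCuspidalEigenclassOfClean
import HarnessLib

/-!
# Hecke equivariance of the Eichler–Shimura–Harder class of a clean Bianchi cusp form

For the family data `D : GL2CESH.FamilyData K hcpt` of a clean cuspidal `π` of `GL₂(𝔸_K)`
(`GL2CESHFamilyDeriv`, `GL2CESHFamily`) the van Est class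
`[F] = GL2C.vanEstClass (D.isAutomorphicFamily h2) ∈ H¹(S_{K_f(𝔫)}, E_λ(ℂ))` is an eigenclass
of the unramified Hecke operators `T_{v,i} = [K_f(𝔫) t_{v,i} K_f(𝔫)]`, `v ∤ 𝔫`, with the
eigenvalues `q_v^{i(2−i)/2} e_i(α_v)` of the Satake parameters `α_v` of `π`
(`heckeT_vanEstClass`).  By `GL2C.heckeEnd_vanEstClass_eq_smul` it suffices that the family be an
eigenfamily of the double coset operator in the finite variable (`heckeFun_family_eq_smul`); the
family is built from the values of finitely many `K(𝔫)`-fixed forms of `W`, on which the global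
double coset sum is the local one at the unramified place `v` (`IsUnramifiedLevel`,
`heckeFun_apply_eq_sum_local`) and the local sum acts by the Satake scalar — Flath's theorem in
the tree's form `Flath1979_heckeOperator_ofLocal_sub_smul_mem_holds` with the uniqueness of
Satake parameters (`sum_translate_eq_smul`).
[cite: Harder1987, §3] [cite: FlathCorvallis1979, Thm. 3] [cite: KhareThorne2017, §6.2]

Theorems only; no named fact.
-/

noncomputable section

-- Mathlib idiom (Mathlib/Algebra/Lie/OfAssociative.lean), as in `GL2CCuspFormOps`.
attribute [local instance 100] LieRing.ofAssociativeRing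

open scoped Matrix ComplexConjugate MatrixGroups Topology Matrix.Norms.Operator BigOperators NNReal
open Complex Finset MulAction

namespace Literature.NumberTheory.Automorphic

namespace GL2CESH

namespace FamilyData

open scoped Classical
open _root_.NumberField _root_.NumberField.InfinitePlace _root_.NumberField.mixedEmbedding IsDedekindDomain
open RealMatrixGroup ComplexPlace ImaginaryQuadratic GL2CCoeff GL2CAut GL2CKType GL2CCuspForm GL2C
open AutomorphicRepData GL2CESHMat Matrix ResGLnCohomology TwistedQuotient

variable {K : Type} [Field K] [NumberField K] [IsTotallyComplex K] {hcpt : isCompact_glFiniteIntegralLevel 2 K}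
  (D : FamilyData K hcpt)

/-- The local compact open `K_v = GL₂(𝒪_v)`. [folklore] -/
abbrev Kv (v : HeightOneSpectrum (𝓞 K)) : Subgroup (GL (Fin 2) (v.adicCompletion K)) :=
  (valuedCongruenceSubgroup (Fin 2) (1 : WithZero (Multiplicative ℤ)) : Subgroup (GL (Fin 2) (v.adicCompletion K)))

/-- The local Hecke matrix `t_{v,i} = diag(ϖ_v × i, 1 × (2 − i))`. [folklore] -/
abbrev tLoc (v : HeightOneSpectrum (𝓞 K)) (i : ℕ) : GL (Fin 2) (v.adicCompletion K) :=
  glDiagonal 2 (v.adicCompletion K) fun l => if l.val < i then BigHeckeGLn.uniformizerAt v else 1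

omit [IsTotallyComplex K] in
/-- `K_v t_{v,i} K_v / K_v` is finite. [folklore] -/
theorem finite_orbit_tLoc (v : HeightOneSpectrum (𝓞 K)) (i : ℕ) :
    (orbit (Kv (K := K) v) ((tLoc (K := K) v i : GL (Fin 2) (v.adicCompletion K)) :
      GL (Fin 2) (v.adicCompletion K) ⧸ Kv (K := K) v)).Finite := by
  haveI := isHeckeTriple_top_of_isCompact_isOpen _
    (isCompact_valuedCongruenceSubgroup_one 2 K v) (isOpen_valuedCongruenceSubgroup_one 2 K v)
  exact finite_orbit_quotient (K := Kv (K := K) v) _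

omit [IsTotallyComplex K] in
/-- The `Quotient.out` representatives of a finite set of cosets form a transversal. [folklore] -/
theorem bijOn_image_out {v : HeightOneSpectrum (𝓞 K)} {S : Set (GL (Fin 2) (v.adicCompletion K) ⧸ Kv (K := K) v)}
    (hS : S.Finite) :
    Set.BijOn (fun y : GL (Fin 2) (v.adicCompletion K) => (y : GL (Fin 2) (v.adicCompletion K) ⧸ Kv (K := K) v))
      (hS.toFinset.image Quotient.out) S := by
  refine ⟨?_, ?_, ?_⟩
  · rintro _ hy
    rw [Finset.coe_image, Set.mem_image] at hy
    obtain ⟨c, hc, rfl⟩ := hy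
    rw [Finset.mem_coe, Set.Finite.mem_toFinset] at hc
    dsimp only
    rwa [QuotientGroup.out_eq']
  · rintro y₁ hy₁ y₂ hy₂ hxy
    rw [Finset.coe_image, Set.mem_image] at hy₁ hy₂
    obtain ⟨c₁, -, rfl⟩ := hy₁
    obtain ⟨c₂, -, rfl⟩ := hy₂
    dsimp only at hxy
    rw [QuotientGroup.out_eq', QuotientGroup.out_eq'] at hxy
    rw [hxy]
  · intro c hc
    refine ⟨c.out, ?_, QuotientGroup.out_eq' c⟩
    rw [Finset.coe_image, Set.mem_image]
    exact ⟨c, by rwa [Finset.mem_coe, Set.Finite.mem_toFinset], rfl⟩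

/-- **The local double coset sum acts on the `K(𝔫)`-fixed forms of a clean `π` by the Satake
scalar**: for `v ∤ 𝔫`, `π` with Satake parameter `α` at `v`, `i ≤ 2` and `ψ ∈ W^{K(𝔫)}`,
`∑_{y K_v ⊆ K_v t_{v,i} K_v} ψ(g ι_v(y)) = q_v^{i(2−i)/2} e_i(α) ψ(g)` (Flath's theorem in the
tree's form, uniqueness of Satake parameters, `W' = 0`). [cite: FlathCorvallis1979, Thm. 3]
[cite: BorelJacquetCorvallis1979, §4.6] -/
theorem sum_translate_eq_smul {v : HeightOneSpectrum (𝓞 K)} (hv : ¬ v.asIdeal ∣ D.𝔫) {α : Multiset ℂ}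
    (hα : D.π.HasSatakeParamAt v α) {i : ℕ} (hi : i ≤ 2) (ψ : D.π.W) (hψ : ψ ∈ GL2CCuspForm.levelFixed D.π D.𝔫)
    (g : GL (Fin 2) (AdeleRing (𝓞 K) K)) :
    ∑ y ∈ (finite_orbit_tLoc (K := K) v i).toFinset, (ψ : (AdelicGroupData.gl 2 K).Adelic → ℂ) (g * GLn.ofLocal 2 K v y.out) =
      heckeEigenvalueOf 2 v α i * (ψ : (AdelicGroupData.gl 2 K).Adelic → ℂ) g := by
  by_cases hψ0 : ψ = 0
  · subst hψ0
    rw [Submodule.coe_zero]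
    change ∑ y ∈ (finite_orbit_tLoc (K := K) v i).toFinset, (0 : ℂ) = heckeEigenvalueOf 2 v α i * 0
    rw [Finset.sum_const_zero, mul_zero]
  have hW' : (ψ : (AdelicGroupData.gl 2 K).Adelic → ℂ) ∉ D.π.W' := by
    rw [D.h, Submodule.mem_bot]
    exact fun h0 => hψ0 (Subtype.ext h0)
  obtain ⟨α', hα', hmod⟩ := D.π.exists_hasSatakeParamAt_and_sum_rightTranslation_sub_smul_mem_of_sub_mem
    D.π.Flath1979_heckeOperator_ofLocal_sub_smul_mem_holds D.h𝔫 hv ψ.2 hW' hψ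
  have hαα : α' = α := D.π.hasSatakeParamAt_unique_holds hα' hα
  subst hαα
  set S := (finite_orbit_tLoc (K := K) v i).toFinset with hS
  have key := hmod i hi (S.image Quotient.out) (bijOn_image_out (finite_orbit_tLoc (K := K) v i)) ψ ψ.2
    (fun u hu => by rw [hψ u hu, sub_self]; exact Submodule.zero_mem _)
  rw [D.h, Submodule.mem_bot, sub_eq_zero] at key
  have hinj : ∀ a ∈ S, ∀ b ∈ S, (a.out : GL (Fin 2) (v.adicCompletion K)) = b.out → a = b := fun a _ b _ hab => by
    rw [← QuotientGroup.out_eq' a, ← QuotientGroup.out_eq' b, hab]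
  have := congrFun key g
  rw [Finset.sum_apply, Finset.sum_image hinj, Pi.smul_apply, smul_eq_mul] at this
  rw [heckeEigenvalueOf]
  simp only [rightTranslation_apply] at this
  convert this using 2
  rfl

/-- **The family is an eigenfamily of `[K_f(𝔫) t_{v,i} K_f(𝔫)]` in the finite variable** with the
Satake eigenvalue. [cite: Harder1987, §3] [cite: KhareThorne2017, §6.2] -/
theorem heckeFun_family_eq_smul (h2 : Module.finrank ℚ K = 2) {v : HeightOneSpectrum (𝓞 K)} (hv : ¬ v.asIdeal ∣ D.𝔫)
    {α : Multiset ℂ} (hα : D.π.HasSatakeParamAt v α) {i : ℕ} (hi : i ≤ 2)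
    (q : BigHeckeGLn.FiniteAdelicGL 2 K ⧸ ResGLnCohomology.level 2 K D.𝔫) (X M : Mat) :
    ArithmeticQuotient.heckeFun ℂ (ResGLnCohomology.level 2 K D.𝔫) (BigHeckeGLn.heckeElement 2 K v i)
        (ResGLnCohomology.CoeffModule ℂ 2 K D.lam) (fun q' => D.family q'.out X M) q =
      heckeEigenvalueOf 2 v α i • D.family q.out X M := by
  have hunr : ArithmeticQuotient.IsUnramifiedLevel (Kv (K := K) v) (BigHeckeGLn.ofLocal 2 K v)
      (BigHeckeGLn.localComponent 2 K v) (ResGLnCohomology.level 2 K D.𝔫) :=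
    BigHeckeGLn.isUnramifiedLevel_comap_principalCongruenceLevel (n := 2) (K := K) D.h𝔫 hv
  have ha := finite_orbit_tLoc (K := K) v i
  conv_lhs => rw [← QuotientGroup.out_eq' q, BigHeckeGLn.heckeElement_eq_ofLocal]
  rw [hunr.heckeFun_apply_eq_sum_local ha]
  -- each summand through `apply_out`, `family_eq_sum` and `pt M (c u) = pt M c (1,u)`
  have hterm : ∀ y ∈ ha.toFinset,
      D.family (((q.out * BigHeckeGLn.ofLocal 2 K v y.out : BigHeckeGLn.FiniteAdelicGL 2 K) :
        BigHeckeGLn.FiniteAdelicGL 2 K ⧸ ResGLnCohomology.level 2 K D.𝔫)).out X M =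
        ∑ l ∈ range (D.d + 1), ∑ m ∈ range (D.d + 1),
          (((D.ηX X : ℕ → ℕ → D.π.W) l m : D.π.W) : (AdelicGroupData.gl 2 K).Adelic → ℂ)
              (pt K (toGL M) q.out * GLn.ofLocal 2 K v y.out) •
            coeffRepC K D.lam (toGL M) (D.Θ (Ops.single D.d l m)) := by
    intro y _
    have hof : GLn.ofFinite 2 K (BigHeckeGLn.ofLocal 2 K v y.out) = GLn.ofLocal 2 K v y.out :=
      GLn.ofFinite_sndHom_ofLocal v y.out
    rw [(D.isAutomorphicFamily h2).apply_out, family_eq_sum, pt_mul_finite, hof]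
  rw [Finset.sum_congr rfl hterm, Finset.sum_comm]
  rw [family_eq_sum, Finset.smul_sum]
  refine Finset.sum_congr rfl fun l _ => ?_
  rw [Finset.sum_comm, Finset.smul_sum]
  refine Finset.sum_congr rfl fun m _ => ?_
  rw [← Finset.sum_smul, D.sum_translate_eq_smul hv hα hi _ (D.ηX_mem_levelFixed X l m), mul_smul]

attribute [local instance] completeSpace_coeffModule

/-- **The van Est class of the Eichler–Shimura–Harder family is a Hecke eigenclass away from the
level**: `T_{v,i} [F] = q_v^{i(2−i)/2} e_i(α_v) [F]` for `v ∤ 𝔫`, `i ≤ 2`, `α_v` the Satake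
parameter of `π` at `v`. [cite: Harder1987, §3] [cite: Clozel1990, §3.5 (p. 123)] -/
theorem heckeT_vanEstClass (h2 : Module.finrank ℚ K = 2) {v : HeightOneSpectrum (𝓞 K)} (hv : ¬ v.asIdeal ∣ D.𝔫)
    {α : Multiset ℂ} (hα : D.π.HasSatakeParamAt v α) {i : ℕ} (hi : i ≤ 2) :
    ResGLnCohomology.heckeT ℂ 2 K D.𝔫 D.lam 1 v i (GL2C.vanEstClass (D.isAutomorphicFamily h2)) =
      heckeEigenvalueOf 2 v α i • GL2C.vanEstClass (D.isAutomorphicFamily h2) :=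
  GL2C.heckeEnd_vanEstClass_eq_smul (D.isAutomorphicFamily h2) fun q X _ M _ =>
    D.heckeFun_family_eq_smul h2 hv hα hi q X M

end FamilyData

end GL2CESH

end Literature.NumberTheory.Automorphic

end
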